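import Summits.BirchSwinnertonDyer.BirchSwinnertonDyer.Theses.AdditiveBranchIMC
import Summits.BirchSwinnertonDyer.BirchSwinnertonDyer.Theorems.AdditiveBranchIMCGordTwoRankOneCM
import Summits.BirchSwinnertonDyer.Rank1Residual.Additive.GordIsogenyInvariance
import HarnessLib

/-!
# Route `AdditiveBranchIMC` (rung K1), crux `GordTwoRankOne` (item 19358): the CERTIFIED SEAM for the
# deferred content split (TARGET E68 spec (b)) — the route decl BY NAME from the route's own support items
# `PrintedFacts` ∧ `ReadingFacts`, ten further PUBLISHED named facts, and EXACTLY THREE displayed inputs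
# (cell `bsd-addord`, seat `bsd-addord-k1-c3` gen 2; `--supports stmt-BirchSwinnertonDyer-19358 --as helper`)

HONEST FRAMING. THEOREMS ONLY; nothing asserted, nothing booked; the crux stays OPEN. This file is the
kernel-checked form of the planner's deferred split spec (b) for item 19358 (TARGET v6.25 E68: children
`GordTwoLambdaDivEven` / `GordTwoLambdaDivOdd` / `GordTwoClassCert` / `GordTwoRankOneCM` + glue), updated by
the sibling file `…GordTwoRankOneCM.lean`: the CM child is NO LONGER A CHILD — it is discharged from print
(Li–Liu–Tian 2024 Thm. 1.1 (i), binder `hLLT`), so the split has THREE content children, spelled INLINE below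
exactly as a planner would file them (rank-free Λ-adic branch lower containment on the off-Case-1 slice, per
parity; the certificate `A′ ≠ 0` on the NON-CM pairs of analytic rank `1`), and the glue

  `PrintedFacts → ReadingFacts → [hMaz hCyc hCyc3 hArt h73 hWald hDel hDel3 hmodN hLLT] →
     (Λ-even) → (Λ-odd) → (cert on ¬CM) → GordTwoRankOne`

is PROVED here (`gordTwoRankOne_of_parts`), the route decl concluded BY NAME; the ∀-certificate child is read
on each isogeny class through the cell's `ℚ`-isogeny invariance (`N10.cellGordTwo_of_isIsogenous`, from the
tree's `GordIsogenyInvariance`; analytic rank and CM are invariants too), so no analytic isogeny-invariance of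
`A′` is needed for the glue. Variants: `…_classCert` (certificate child stated on classes) and `…_caseSplit`
(the BC3 skeleton's Case-1 / off-Case-1 cut, with the Λ-adic input asked only IN RANK `1` on non-CM
off-Case-1 pairs — weaker children, same glue). The ten bracketed binders are
the rank-`1` published inputs NOT among the conjuncts of `PrintedFacts`/`ReadingFacts` (Mazur 1972 Cor. 5.15;
lit's conjoined Disegni 2017 Thm. A/B ÷ YZZ + Delbourgo 2002 Thm. (B) facts (B)/(B₃); Artin formalism;
Gross–Zagier I (7.3); Waldspurger/BFH; Delbourgo 2002 Thm. (A)–(B) at `p ≥ 5` and at `p = 3`; existence of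
the newform; Li–Liu–Tian 2024) — each a cite-tagged `def … : Prop` of the tree, to be item-stated as
cite_only leaves if the planner executes the split (K3/E2 shape, as for 19361/19362).

Also: `gordTwoRankOne_iff_parts_of_facts`-type bookkeeping is NOT claimed (the children are NOT consequences
of the parent: the Λ-adic layer is strictly stronger than the `T = 0` lower bound off the surjective rows).

References: cell TARGET.md E68 (spec (b)), E74; [LiLiuTian2024] Thm. 1.1 (i); [Delbourgo2002] Thm. (A), (B);
[Disegni2017] Thm. A, B; [Mazur1972Towers] Cor. 5.15; [GrossZagier1986] I (7.3); [Miller2011LMS] Def. 1.1.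
-/

set_option autoImplicit false
set_option linter.dupNamespace false

noncomputable section

open scoped Classical MatrixGroups ModularForm NumberField

open CongruenceSubgroup WeierstrassCurve NumberField IsDedekindDomain Field
  Literature.NumberTheory.EllipticCurves Literature.NumberTheory.EllipticCurves.ModularForms
  Literature.NumberTheory.EllipticCurves.GreenbergVatsal2000
  Literature.NumberTheory.EllipticCurves.Rank1Residual
  Literature.NumberTheory.EllipticCurves.Rank1Residual.Typed
  Literature.NumberTheory.EllipticCurves.Delbourgo2002
  Literature.NumberTheory.EllipticCurves.Disegni2017
  Literature.NumberTheory.GaloisRepresentations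
  Summit.BirchSwinnertonDyer.Rank1Residual.AdditivePotMult
  Summit.BirchSwinnertonDyer.Rank1Residual.Additive
  Summit.BirchSwinnertonDyer.Rank1Residual.X12
  Summit.BirchSwinnertonDyer.BirchSwinnertonDyer.Theses.AdditiveBranchIMC

namespace Summit.BirchSwinnertonDyer.BirchSwinnertonDyer.Theorems.AdditiveBranchIMCGordTwoRankOne

/-- **Cell (G-ord, `e = 2`) is a `ℚ`-isogeny invariant** (globally minimal models, odd `p`): additivity on
the (G)-cell (`Addv.of_isIsogenous_of_typeG`), (G)-ordinarity (`TypeGOrd.of_isIsogenous`) and the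
semistability defect (`semistabilityIndex_eq_of_isIsogenous_of_typeG_of_addv`) all transfer along an isogeny
— the tree's `GordIsogenyInvariance` bundled for the route's cell predicate. So a hypothesis quantified over
ALL pairs of the cell (a would-be child item) may be read at every member of an isogeny class.
[cite: SilvermanAEC2009, VII.7.2 (isogenous curves have the same reduction type)] -/
theorem N10.cellGordTwo_of_isIsogenous {W W' : WeierstrassCurve ℚ} [W.IsElliptic] [W.IsGloballyMinimal]
    [W'.IsElliptic] [W'.IsGloballyMinimal] {p : ℕ} [Fact p.Prime] (hc : N10.CellGordTwo W p)
    (h : IsIsogenous W W') : N10.CellGordTwo W' p := by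
  obtain ⟨hp2, hadd, hG, he⟩ := hc
  exact ⟨hp2, Addv.of_isIsogenous_of_typeG hadd hG.typeG h, hG.of_isIsogenous hp2 hadd h,
    (semistabilityIndex_eq_of_isIsogenous_of_typeG_of_addv hp2 hadd hG.typeG h).trans he⟩

/-- **A certificate quantified over ALL non-CM pairs of the cell in analytic rank `1` is a CLASS
certificate at each pair** (analytic rank: `analyticRank_eq_of_isIsogenous'`; cell:
`N10.cellGordTwo_of_isIsogenous`; CM: `hasCM_iff_of_isIsogenous`). Bookkeeping for the glue below.
[cite: MilneADT2006, Thm. I.7.3] -/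
theorem classCert_of_forall_branchCoeffOneNeZeroAt
    (hCert : ∀ (W : WeierstrassCurve ℚ) [W.IsElliptic] [W.IsGloballyMinimal] (p : ℕ) [Fact p.Prime],
      W.analyticRank = 1 → N10.CellGordTwo W p → ¬ W.HasCM → BranchCoeffOneNeZeroAt W p)
    {W : WeierstrassCurve ℚ} [W.IsElliptic] [W.IsGloballyMinimal] {p : ℕ} [Fact p.Prime]
    (hr : W.analyticRank = 1) (hc : N10.CellGordTwo W p) (hcm : ¬ W.HasCM) :
    ∀ (W' : WeierstrassCurve ℚ) [W'.IsElliptic] [W'.IsGloballyMinimal],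
      IsIsogenous W W' → BranchCoeffOneNeZeroAt W' p :=
  fun W' _ _ hiso ↦
    hCert W' p ((analyticRank_eq_of_isIsogenous' hiso).symm.trans hr) (N10.cellGordTwo_of_isIsogenous hc hiso)
      fun h' ↦ hcm ((hasCM_iff_of_isIsogenous hiso).mpr h')

/-- **THE CERTIFIED SEAM of the content split of crux `GordTwoRankOne` (item 19358).** From the route's
support items `PrintedFacts` (item 19362: GV datum Selmer, Greenberg 4.14 / Kummer, Delbourgo 1998 Prop. 4
weak form, GZK, modularity, modular parametrisation, Cassels) and `ReadingFacts` (item 19361: Wuthrich Thm. 16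
half, GV (3.12) branch reading, the two GV liftings, Delbourgo Prop. 4 unit form) BY NAME, the ten rank-`1`
PUBLISHED named facts not among their conjuncts (`hMaz` Mazur 1972 Cor. 5.15, `hCyc`/`hCyc3` lit's conjoined
Disegni–Delbourgo facts, `hArt` Artin formalism, `h73` Gross–Zagier I (7.3), `hWald` Waldspurger, `hDel`/`hDel3`
Delbourgo 2002 Thm. (A)–(B), `hmodN` newform, `hLLT` Li–Liu–Tian 2024 Thm. 1.1 (i)), and EXACTLY THREE
displayed inputs spelled as the would-be children — (Λ-even) the branch lower containment
`ChiBranchLowerDivisibilityAt` on the off-Case-1 slice at `p ≡ 1 (mod 4)`, (Λ-odd) its minus-symbol twin at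
`p ≡ 3 (mod 4)` (items 19244/19245's rank-free layer; NOT in print), (cert) `A′ ≠ 0` on every NON-CM pair of
the cell in analytic rank `1` (Schneider non-degeneracy in certificate form; numerically discharged per class)
— the route decl `GordTwoRankOne` follows BY NAME. Proof: unpack the two conjunctions and apply the sibling
file's `gordTwoRankOne_of_facts_of_chiBranchLower_of_branchCoeffOneNeZero_of_liLiuTian`. Nothing asserted.
[cite: LiLiuTian2024, Thm. 1.1 (i)] [cite: Delbourgo2002, Theorem (A), (B) (p. 40)] [cite: Disegni2017, Theorem A/B]
[cite: Mazur1972Towers, Cor. 5.15] [cite: Miller2011LMS, Def. 1.1] -/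
theorem gordTwoRankOne_of_parts (hP : PrintedFacts) (hR : ReadingFacts)
    (hMaz : Mazur1972.cor515_universalNormIndex) (hCyc : delbourgoDatum_cycLineGrossZagier)
    (hCyc3 : delbourgoDatum_cycLineGrossZagier_intrinsicThree)
    (hArt : rankinSelbergEulerProductHecke_baseChangeDirichlet_eq) (h73 : GrossZagier1986_thm_I_7_3)
    (hWald : waldspurger_exists_heegnerField_twist_ne_zero) (hDel : Delbourgo2002.mainTheorem)
    (hDel3 : Delbourgo2002.mainTheorem_three) (hmodN : exists_isNewformOf)
    (hLLT : LiLiuTian2024.thm11_bsdp_of_cm_rank_one)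
    (hΛ : ∀ (W : WeierstrassCurve ℚ) [W.IsElliptic] [W.IsGloballyMinimal] (p : ℕ) [Fact p.Prime],
      N10.CellGordTwo W p → ¬ HasCaseOneMember W p → p % 4 = 1 → ChiBranchLowerDivisibilityAt W p)
    (hΛ' : ∀ (W : WeierstrassCurve ℚ) [W.IsElliptic] [W.IsGloballyMinimal] (p : ℕ) [Fact p.Prime],
      N10.CellGordTwo W p → ¬ HasCaseOneMember W p → p % 4 = 3 → ChiBranchLowerDivisibilityOddAt W p)
    (hCert : ∀ (W : WeierstrassCurve ℚ) [W.IsElliptic] [W.IsGloballyMinimal] (p : ℕ) [Fact p.Prime],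
      W.analyticRank = 1 → N10.CellGordTwo W p → ¬ W.HasCM → BranchCoeffOneNeZeroAt W p) :
    GordTwoRankOne := by
  obtain ⟨h23, h414, hGrK, -, hGZK, hmod, hmodD, hCassels⟩ := hP
  obtain ⟨hW16, hGV, hLiftF, hLiftE, -⟩ := hR
  intro W _ _ p _ hr hc
  exact gordTwoRankOne_of_facts_of_chiBranchLower_of_classCert_of_liLiuTian hW16 hGV h23 h414 hGrK hLiftF
    hLiftE hMaz hCyc hCyc3 hArt h73 hWald hDel hDel3 hmod hmodD hmodN hGZK hCassels hLLT hΛ hΛ' W p hr hc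
    (classCert_of_forall_branchCoeffOneNeZeroAt hCert hr hc)

/-- **The same seam with the certificate read on the CLASS** (one number per isogeny class, computed at ANY
member — E74 §1): (cert) becomes `¬CM → ∀ W′ ~ W, BranchCoeffOneNeZeroAt W′ p`.
[cite: LiLiuTian2024, Thm. 1.1 (i)] [cite: MilneADT2006, Thm. I.7.3] [cite: Miller2011LMS, Def. 1.1] -/
theorem gordTwoRankOne_of_parts_classCert (hP : PrintedFacts) (hR : ReadingFacts)
    (hMaz : Mazur1972.cor515_universalNormIndex) (hCyc : delbourgoDatum_cycLineGrossZagier)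
    (hCyc3 : delbourgoDatum_cycLineGrossZagier_intrinsicThree)
    (hArt : rankinSelbergEulerProductHecke_baseChangeDirichlet_eq) (h73 : GrossZagier1986_thm_I_7_3)
    (hWald : waldspurger_exists_heegnerField_twist_ne_zero) (hDel : Delbourgo2002.mainTheorem)
    (hDel3 : Delbourgo2002.mainTheorem_three) (hmodN : exists_isNewformOf)
    (hLLT : LiLiuTian2024.thm11_bsdp_of_cm_rank_one)
    (hΛ : ∀ (W : WeierstrassCurve ℚ) [W.IsElliptic] [W.IsGloballyMinimal] (p : ℕ) [Fact p.Prime],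
      N10.CellGordTwo W p → ¬ HasCaseOneMember W p → p % 4 = 1 → ChiBranchLowerDivisibilityAt W p)
    (hΛ' : ∀ (W : WeierstrassCurve ℚ) [W.IsElliptic] [W.IsGloballyMinimal] (p : ℕ) [Fact p.Prime],
      N10.CellGordTwo W p → ¬ HasCaseOneMember W p → p % 4 = 3 → ChiBranchLowerDivisibilityOddAt W p)
    (hCert : ∀ (W : WeierstrassCurve ℚ) [W.IsElliptic] [W.IsGloballyMinimal] (p : ℕ) [Fact p.Prime],
      W.analyticRank = 1 → N10.CellGordTwo W p → ¬ W.HasCM →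
      ∀ (W' : WeierstrassCurve ℚ) [W'.IsElliptic] [W'.IsGloballyMinimal],
        IsIsogenous W W' → BranchCoeffOneNeZeroAt W' p) :
    GordTwoRankOne := by
  obtain ⟨h23, h414, hGrK, -, hGZK, hmod, hmodD, hCassels⟩ := hP
  obtain ⟨hW16, hGV, hLiftF, hLiftE, -⟩ := hR
  intro W _ _ p _ hr hc
  exact gordTwoRankOne_of_facts_of_chiBranchLower_of_classCert_of_liLiuTian hW16 hGV h23 h414 hGrK hLiftF
    hLiftE hMaz hCyc hCyc3 hArt h73 hWald hDel hDel3 hmod hmodD hmodN hGZK hCassels hLLT hΛ hΛ' W p hr hc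
    (hCert W p hr hc)

/-- **The two registered stubs of the BC3 skeleton, jointly, modulo the same displayed inputs — with the
Λ-adic input asked only where it is used**: the skeleton's composition `GordTwoRankOne_of stub_caseOne
stub_offCaseOne` re-derived with each stub replaced by its displayed-input form — `stub_caseOne`'s rows (a
Case-1 member) need NO Λ-adic input (gz's end states via E68 §1), `stub_offCaseOne`'s rows need the branch
lower containment AT THAT PAIR, in analytic rank `1`, non-CM (`hOff`: weaker than the rank-free children
`hΛ`/`hΛ'`); both need the ∀-certificate on non-CM pairs; CM rows of either need nothing (LLT). Recorded so
the planner may equally keep spec (a)'s Case-1 / off-Case-1 cut. [cite: LiLiuTian2024, Thm. 1.1 (i)]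
[cite: Delbourgo2002, Theorem (A), (B) (p. 40)] [cite: Miller2011LMS, Def. 1.1] -/
theorem gordTwoRankOne_of_parts_caseSplit (hP : PrintedFacts) (hR : ReadingFacts)
    (hMaz : Mazur1972.cor515_universalNormIndex) (hCyc : delbourgoDatum_cycLineGrossZagier)
    (hCyc3 : delbourgoDatum_cycLineGrossZagier_intrinsicThree)
    (hArt : rankinSelbergEulerProductHecke_baseChangeDirichlet_eq) (h73 : GrossZagier1986_thm_I_7_3)
    (hWald : waldspurger_exists_heegnerField_twist_ne_zero) (hDel : Delbourgo2002.mainTheorem)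
    (hDel3 : Delbourgo2002.mainTheorem_three) (hmodN : exists_isNewformOf)
    (hLLT : LiLiuTian2024.thm11_bsdp_of_cm_rank_one)
    (hOff : ∀ (W : WeierstrassCurve ℚ) [W.IsElliptic] [W.IsGloballyMinimal] (p : ℕ) [Fact p.Prime],
      W.analyticRank = 1 → N10.CellGordTwo W p → ¬ HasCaseOneMember W p → ¬ W.HasCM →
      (p % 4 = 1 → ChiBranchLowerDivisibilityAt W p) ∧ (p % 4 = 3 → ChiBranchLowerDivisibilityOddAt W p))
    (hCert : ∀ (W : WeierstrassCurve ℚ) [W.IsElliptic] [W.IsGloballyMinimal] (p : ℕ) [Fact p.Prime],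
      W.analyticRank = 1 → N10.CellGordTwo W p → ¬ W.HasCM → BranchCoeffOneNeZeroAt W p) :
    GordTwoRankOne := by
  obtain ⟨h23, h414, hGrK, -, hGZK, hmod, hmodD, hCassels⟩ := hP
  obtain ⟨hW16, hGV, hLiftF, hLiftE, -⟩ := hR
  intro W _ _ p _ hr hc
  by_cases hcm : W.HasCM
  · exact gordTwoRankOne_cm_of_liLiuTian hLLT W p hr hc hcm
  by_cases hm : HasCaseOneMember W p
  · exact gordTwoRankOne_caseOne_of_facts_of_classCert hW16 hGV h23 h414 hGrK hLiftF hLiftE hMaz hCyc hCyc3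
      hArt h73 hWald hDel hDel3 hmod hmodD hmodN hGZK hCassels W p hr hc hcm
      (classCert_of_forall_branchCoeffOneNeZeroAt hCert hr hc hcm) hm
  · -- off Case 1: the Λ-adic input at THIS pair and in THIS rank suffices (the model-keyed cores of E68 §0 /
    -- `…OffCaseOne` / `…OddBranch` are per pair).
    have hne : BranchCoeffOneNeZeroAt W p := hCert W p hr hc hcm
    rcases Nat.lt_or_ge p 4 with hp4 | hp4
    · -- p = 3 (p odd prime < 4)
      have hp3 : p = 3 := by
        have hp2 : p ≠ 2 := hc.1
        have h2 := (Fact.out : p.Prime).two_le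
        interval_cases p
        · exact absurd rfl hp2
        · rfl
      subst hp3
      exact cellGordTwo_missingLowerBoundAt_rankOne_three_intrinsic_of_facts_of_chiBranchLowerOdd_of_branchCoeffOneNeZero
        hMaz hCyc3 hArt h73 hWald hDel3 hmod hmodD hmodN hGZK hc hcm hr ((hOff W 3 hr hc hm hcm).2 rfl) hne
    · have hodd : p % 4 = 1 ∨ p % 4 = 3 := by
        obtain ⟨k, hk⟩ := (Fact.out : p.Prime).odd_of_ne_two hc.1
        omega
      rcases hodd with h1 | h3
      · exact cellGordTwo_missingLowerBoundAt_rankOne_of_facts_of_chiBranchLower_of_branchCoeffOneNeZero hMaz hCyc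
          hArt h73 hWald hDel hmod hmodD hmodN hGZK hc h1 hcm hr ((hOff W p hr hc hm hcm).1 h1) hne
      · have hp5 : 5 ≤ p := by omega
        exact cellGordTwo_missingLowerBoundAt_rankOne_odd_of_facts_of_chiBranchLowerOdd_of_branchCoeffOneNeZero hMaz
          hCyc hArt h73 hWald hDel hmod hmodD hmodN hGZK hc h3 hp5 hcm hr ((hOff W p hr hc hm hcm).2 h3) hne

end Summit.BirchSwinnertonDyer.BirchSwinnertonDyer.Theorems.AdditiveBranchIMCGordTwoRankOne

end
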